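import Summits.KontsevichZagierPeriods.KontsevichZagierPeriods.Theorems.RootDecompZetaThreeFrontierWordOrdersThreeP2

/-! # `RootDecompZetaThreeFrontierGZLadderThreeOrders` — part 3/3 of the mechanical ≤330-line split of `OrdersThree.stripped.lean`
(split by the decomp-kz census seat for landing; mathematics unchanged; part 3 continues part 2). -/

noncomputable section
set_option linter.dupNamespace false
open Set MeasureTheory MvPolynomial
open Literature.NumberTheory.Transcendental
open Literature.ModelTheory.ExponentialFields (IsSemialgebraic)
set_option linter.dupNamespace false

namespace Summit.KontsevichZagierPeriods.KontsevichZagierPeriods.Cruxes.GZNormalFormWThree.GZLadder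
open Set MeasureTheory Literature.NumberTheory.Transcendental

/-- a layer datum is a reduced datum with orders (all five orders `0`): the layer is the order-`0` part of `IsReducedOrdThree` -/
theorem isReducedOrdThree_of_isLayerThree_shape (r : KZ.IntegralRep 3) (hd : r.domain = simplex 3)
    (p : MvPolynomial (Fin 3) ℚ) (β₀ β₁ γ₁ γ₂ α : ℕ)
    (hα : α ≤ 1) (hβ : β₁ ≤ 1) (hγ : γ₁ ≤ 1) (h0 : β₀ + β₁ + α ≤ 2) (h1 : γ₂ + γ₁ + α ≤ 2)
    (hi : EqOn r.integrand (fun t => MvPolynomial.aeval t p /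
      (t 0 ^ β₀ * t 1 ^ β₁ * (1 - t 1) ^ γ₁ * (1 - t 2) ^ γ₂ * (t 0 - t 2) ^ α)) r.domain) :
    IsReducedOrdThree r :=
  ⟨hd, p, β₀, β₁, γ₁, γ₂, α, fun _ _ => by omega, fun _ _ => by omega, fun _ _ => by omega, fun _ _ => by omega,
    fun _ _ => by omega, hi⟩

/-- **`gz_ladder.stub_three_orders` (proposed), PROVED** — by `reducedOrders_of_isReduced_three`. -/
theorem stub_three_orders : ∀ r : KZ.IntegralRep 3, IsReducedThree r → IsReducedOrdThree r := by
  rintro r ⟨hd, p, β₀, β₁, γ₁, γ₂, α, hi⟩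
  obtain ⟨h1, h2, h3, h4, h5⟩ :=
    Summit.KontsevichZagierPeriods.KontsevichZagierPeriods.Theorems.RootDecompZetaThreeFrontierWordMoves.reducedOrders_of_isReduced_three
      r hd p β₀ β₁ γ₁ γ₂ α hi
  exact ⟨hd, p, β₀, β₁, γ₁, γ₂, α, h1, h2, h3, h4, h5, hi⟩

end Summit.KontsevichZagierPeriods.KontsevichZagierPeriods.Cruxes.GZNormalFormWThree.GZLadder

end
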